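import Summits.ValiantsHypothesis.ValiantsHypothesis.Theorems.LacunarySymmetroidMatrixDescartesFanLawFourWord
import Summits.ValiantsHypothesis.ValiantsHypothesis.Theorems.LacunarySymmetroidMatrixDescartesFanLawFourMDR

/-!
# `MatrixDescartes` (stmt-ValiantsHypothesis-18050), line `Lift` — the signed word law in CRUX CURRENCY
# (all real zeros under a parity condition; the `MatrixDescartes` inequality on the signed-word sector at fat formats)

HONEST FRAMING.  Cell `pub-symmetroid`, seat `val-sym-mdr-p2` (gen 3); helper `--supports` the crux
`Theses.LacunarySymmetroid.MatrixDescartes`, NO closure claim.  Corollaries of `…FanLawFourWord.lean`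
(`signedWord_posRoots_le`): `signedWord_realRoots_le` (`Z ≤ 4m + 1` when the CONSTRAINED exponents — those different from
the two free exponents `E`, `Ef` — have one parity; the free letters stay free under `X ↦ −X`) and `signedWord_mdr` (the
crux's inequality `Z^q ≤ 2^{K⌊log₂K⌋}` on this sector at every fat format, via `Census.fatFormat_absorb`).  A SECTOR
theorem: nothing here bears on `stub_twoSided` in general, the crux in its window, `DoorA26`/`DoorA34`, or `VP ≠ VNP`.
[folklore] given `…FanLawFourWord.lean`.
-/

-- layout Summits/ValiantsHypothesis/ValiantsHypothesis forces the duplicated namespace component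
set_option linter.dupNamespace false

namespace Summit.ValiantsHypothesis.ValiantsHypothesis.Theorems.LacunarySymmetroidMatrixDescartes

open Polynomial Matrix Finset
open scoped BigOperators
open FanLawFourWord

/-- **Signed word law, all real zeros**: with the constrained exponents of one parity, `F(−X)` (or `−F(−X)`) is again
a signed word with the same free exponents, so `det F` has at most `4m + 1` distinct real zeros. [folklore] -/
theorem signedWord_realRoots_le (K m : ℕ) (d : Fin K → ℕ) (S : Fin K → Matrix (Fin m) (Fin m) ℝ) (E Ef : ℕ)
    (hEf : Ef ≠ E) (hfree : ∀ l, d l = E ∨ d l = Ef → (S l).IsSymm)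
    (hfan : ∀ l, d l ≠ E → d l ≠ Ef →
      ((Ef < E ∧ ((E < d l ∧ d l - E ≤ E - Ef ∧ (S l).PosSemidef)
          ∨ (d l < E ∧ E - d l < E - Ef ∧ (-S l).PosSemidef)
          ∨ (d l < E ∧ E - Ef < E - d l ∧ E - d l ≤ 2 * (E - Ef) ∧ (S l).PosSemidef)))
      ∨ (E < Ef ∧ ((d l < E ∧ E - d l ≤ Ef - E ∧ (S l).PosSemidef)
          ∨ (E < d l ∧ d l - E < Ef - E ∧ (-S l).PosSemidef)
          ∨ (E < d l ∧ Ef - E < d l - E ∧ d l - E ≤ 2 * (Ef - E) ∧ (S l).PosSemidef)))))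
    (hdef : ∃ l, d l ≠ E ∧ d l ≠ Ef ∧
      (((S l).PosDef ∧ ¬ ((Ef < E ∧ d l < E ∧ E - d l < E - Ef) ∨ (E < Ef ∧ E < d l ∧ d l - E < Ef - E)))
        ∨ ((-S l).PosDef ∧ ((Ef < E ∧ d l < E ∧ E - d l < E - Ef) ∨ (E < Ef ∧ E < d l ∧ d l - E < Ef - E)))))
    (hpar : (∀ l, d l ≠ E → d l ≠ Ef → Even (d l)) ∨ (∀ l, d l ≠ E → d l ≠ Ef → Odd (d l))) :
    (Matrix.det (∑ l, ((Polynomial.X : Polynomial ℝ) ^ d l) • (S l).map Polynomial.C)).roots.toFinset.card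
      ≤ 4 * m + 1 := by
  have h1 := signedWord_posRoots_le d S E Ef hEf hfree hfan hdef
  have h3 := stub_negRoots K m d S
  -- a family that agrees with `S` on the constrained letters and is symmetric on the free ones obeys the same bound
  have key : ∀ T : Fin K → Matrix (Fin m) (Fin m) ℝ, (∀ l, d l ≠ E → d l ≠ Ef → T l = S l) →
      (∀ l, d l = E ∨ d l = Ef → (T l).IsSymm) →
      ((Matrix.det (∑ l, ((Polynomial.X : Polynomial ℝ) ^ d l) • (T l).map Polynomial.C)).roots.toFinset.filter
        (fun t => 0 < t)).card ≤ 2 * m := by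
    intro T hT hTs
    refine signedWord_posRoots_le d T E Ef hEf hTs (fun l hl hlf => ?_) ?_
    · rw [hT l hl hlf]; exact hfan l hl hlf
    · obtain ⟨l₁, hl₁E, hl₁f, hl₁⟩ := hdef
      refine ⟨l₁, hl₁E, hl₁f, ?_⟩
      rw [hT l₁ hl₁E hl₁f]; exact hl₁
  have hsymm : ∀ l, d l = E ∨ d l = Ef → (((-1 : ℝ) ^ d l) • S l).IsSymm := fun l hl => (hfree l hl).smul _
  have h2 : ((Matrix.det (∑ l, ((Polynomial.X : Polynomial ℝ) ^ d l) •
      (((-1 : ℝ) ^ d l) • S l).map Polynomial.C)).roots.toFinset.filter (fun t => 0 < t)).card ≤ 2 * m := by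
    rcases hpar with hev | hodd
    · refine key (fun l => ((-1 : ℝ) ^ d l) • S l) (fun l hl hlf => ?_) hsymm
      simp only [(hev l hl hlf).neg_one_pow, one_smul]
    · rw [← roots_det_pencil_neg d (fun l => ((-1 : ℝ) ^ d l) • S l)]
      refine key (fun l => -(((-1 : ℝ) ^ d l) • S l)) (fun l hl hlf => ?_) (fun l hl => (hsymm l hl).neg)
      simp only [(hodd l hl hlf).neg_one_pow, neg_smul, one_smul, neg_neg]
  omega

/-- **`MatrixDescartes` holds on the signed-word sector, at every fat format.**  For all `c, q` there is `K₀` such that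
for all `K ≥ K₀`, all `m ≤ 2^((⌊log₂K⌋+c)^c)`, all words in the sector (two free exponents, constrained letters
semidefinite by position, one of them definite, constrained exponents of one parity): `Z^q ≤ 2^(K⌊log₂K⌋)`.  Nothing is
claimed outside the sector. [folklore] -/
theorem signedWord_mdr (c q : ℕ) : ∃ K₀ : ℕ, ∀ K m : ℕ, K₀ ≤ K → m ≤ 2 ^ ((Nat.log 2 K + c) ^ c) →
    ∀ (d : Fin K → ℕ) (S : Fin K → Matrix (Fin m) (Fin m) ℝ) (E Ef : ℕ), Ef ≠ E →
      (∀ l, d l = E ∨ d l = Ef → (S l).IsSymm) →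
      (∀ l, d l ≠ E → d l ≠ Ef →
        ((Ef < E ∧ ((E < d l ∧ d l - E ≤ E - Ef ∧ (S l).PosSemidef)
            ∨ (d l < E ∧ E - d l < E - Ef ∧ (-S l).PosSemidef)
            ∨ (d l < E ∧ E - Ef < E - d l ∧ E - d l ≤ 2 * (E - Ef) ∧ (S l).PosSemidef)))
        ∨ (E < Ef ∧ ((d l < E ∧ E - d l ≤ Ef - E ∧ (S l).PosSemidef)
            ∨ (E < d l ∧ d l - E < Ef - E ∧ (-S l).PosSemidef)
            ∨ (E < d l ∧ Ef - E < d l - E ∧ d l - E ≤ 2 * (Ef - E) ∧ (S l).PosSemidef))))) →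
      (∃ l, d l ≠ E ∧ d l ≠ Ef ∧
        (((S l).PosDef ∧ ¬ ((Ef < E ∧ d l < E ∧ E - d l < E - Ef) ∨ (E < Ef ∧ E < d l ∧ d l - E < Ef - E)))
          ∨ ((-S l).PosDef ∧ ((Ef < E ∧ d l < E ∧ E - d l < E - Ef) ∨ (E < Ef ∧ E < d l ∧ d l - E < Ef - E))))) →
      ((∀ l, d l ≠ E → d l ≠ Ef → Even (d l)) ∨ (∀ l, d l ≠ E → d l ≠ Ef → Odd (d l))) →
      (Matrix.det (∑ l, ((Polynomial.X : Polynomial ℝ) ^ d l) • (S l).map Polynomial.C)).roots.toFinset.card ^ q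
        ≤ 2 ^ (K * Nat.log 2 K) := by
  obtain ⟨K₀, hK₀⟩ := Census.fatFormat_absorb 2 c q
  refine ⟨K₀, fun K m hK hm d S E Ef hEf hfree hfan hdef hpar => hK₀ K m _ hK hm ?_⟩
  have h := signedWord_realRoots_le K m d S E Ef hEf hfree hfan hdef hpar
  have : 4 * m + 1 ≤ 2 ^ 2 * (m + 1) * (K + 1) := by nlinarith
  exact h.trans this

end Summit.ValiantsHypothesis.ValiantsHypothesis.Theorems.LacunarySymmetroidMatrixDescartes
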